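import Summits.Ventures.HSemireg.WedgeHankelNodeImage
import Summits.Ventures.HSemireg.WedgeHankelSwap

/-!
# Venture HSemireg — THE IMAGE OF THE NODE AT `∞`, NAMED: `V(univ, w_n(rev_n q∞), k′) = coSiegel(n + k′) ⊓ yRich(n + k′, n − P − 1)` — the co-Siegel forms with at least
# `n − P` y-letters (E7's swap applied to F4b; the co-Siegel space is swap-invariant)

HONEST FRAMING. Part of the Lean index of the computation cell `pub-hsemireg` (seat p10 gen 16, Sunday typer «UNIFORM-IN-n»).
Finite-dimensional EXTERIOR ALGEBRA over a field ONLY: no variety, no cohomology theory, no sheaf, no Ext group, no semiregularity map;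
nothing here says that HC / HC_CM / HC_AV holds; no Literature fact is declared or used.  The dictionary (`rev_n q` ↦ the node at `∞`) is QUOTED, never asserted.

THIS FILE (namespace `Summit.Ventures.HSemireg.Wedge.KernelDuality` continued; imports F4b and E7): **`map_Ψs_coSiegel`: `Ψs (coSiegel(j)) = coSiegel(j)`** (the swap negates every
Siegel 2-vector); **`V_w_rev_of_order_eq`: `V(univ, w_n(rev_n q), k′) = coSiegel(k′ + n) ⊓ yRich(k′ + n, n − P − 1)`** for `q` of exact order `P ≤ k′`, `P < n`, `k + k′ = n` — the image of a
node of order `P + 1` at `∞` is the co-Siegel forms with at least `n − P` y-letters; the point (`P = 0`): at least `n` y-letters.  With F4b and F3c every node image on `P¹` is named, and the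
image of every `P¹` divisor class of total order `≤ min(k′+1, n+1−k′)`… (F3c: their direct sum).  Class side only; new names only.
-/

open Module

namespace Summit.Ventures.HSemireg.Wedge.KernelDuality

open Summit.Ventures.HSemireg.Wedge Summit.Ventures.HSemireg.Wedge.Kunneth Summit.Ventures.HSemireg.Wedge.Hankel
  Summit.Ventures.HSemireg.Wedge.HankelSiegel Summit.Ventures.HSemireg.Wedge.HankelSiegelIdeal Summit.Ventures.HSemireg.Wedge.KunnethKernel
  Summit.Ventures.HSemireg.Wedge.HankelSecant Summit.Ventures.HSemireg.Wedge.HankelFrameChange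

variable (K : Type*) [Field K] {n : ℕ}

/-- **THE CO-SIEGEL SPACE IS SWAP-INVARIANT: `Ψs (coSiegel(j)) = coSiegel(j)`** (E7: `Ψs (s_p) = −s_p`, `Ψs` preserves degrees). -/
theorem map_Ψs_coSiegel (j : ℕ) : (coSiegel K n j).map (Ψs K (n := n)).toLinearMap = coSiegel K n j := by
  have hle : (coSiegel K n j).map (Ψs K (n := n)).toLinearMap ≤ coSiegel K n j := by
    rintro _ ⟨θ, hθ, rfl⟩
    obtain ⟨hθj, h0⟩ := mem_coSiegel.mp hθ
    refine mem_coSiegel.mpr ⟨?_, fun p => ?_⟩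
    · rw [Hom_univ_eq_exteriorPower] at hθj ⊢
      exact mapEquiv_mem_exteriorPower K _ hθj
    · have e : sgen K p = -Ψs K (n := n) (sgen K p) := by rw [sgen, Ψs_sv, neg_neg]
      rw [AlgEquiv.toLinearMap_apply, e, mul_neg, ← map_mul, h0 p, map_zero, neg_zero]
  exact Submodule.eq_of_le_of_finrank_eq hle ((Ψs K (n := n)).toLinearEquiv.finrank_map_eq _)

/-- **THE IMAGE OF THE NODE AT `∞`, NAMED: `V(univ, w_n(rev_n q), k′) = coSiegel(k′ + n) ⊓ yRich(k′ + n, n − P − 1)`** for `q` supported on `[0, P]` with `q_P ≠ 0`, `P ≤ k′`,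
`P < n`, `k + k′ = n` — the co-Siegel forms of degree `n + k′` all of whose monomials have at least `n − P` y-letters. -/
theorem V_w_rev_of_order_eq {k k' P : ℕ} (hkk' : k + k' = n) (hP : P ≤ k') (hPn : P < n) {q : ℕ → K} (hq : ∀ j, P < j → q j = 0) (hqP : q P ≠ 0) :
    V K (In n) Finset.univ (w K n n (rev K n q)) k' = coSiegel K n (k' + n) ⊓ yRich K n (k' + n) (n - P - 1) := by
  rw [V_w_rev, V_w_of_order_eq K hkk' hP hPn hq hqP, Submodule.map_inf _ (Ψs K (n := n)).injective, map_Ψs_coSiegel, map_Ψs_xRich]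

/-- **THE IMAGE OF THE POINT `c·δ_n`**: `V(univ, w_n(c·δ_n), k′) = coSiegel(k′ + n) ⊓ yRich(k′ + n, n − 1)` (`c ≠ 0`, `1 ≤ n`, `k′ ≤ n`) — the co-Siegel forms with `n` y-letters. -/
theorem V_w_point_eq {k k' : ℕ} (hkk' : k + k' = n) (hn : 1 ≤ n) {c : K} (hc : c ≠ 0) :
    V K (In n) Finset.univ (w K n n (fun j => if j = n then c else 0)) k' = coSiegel K n (k' + n) ⊓ yRich K n (k' + n) (n - 1) := by
  have e : w K n n (fun j => if j = n then c else 0) = w K n n (rev K n (fun t => if t = 0 then c else 0)) :=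
    HankelRankOne.w_eq_of_agree K n fun i hi => by
      rw [rev_apply_of_le K hi]
      by_cases h : i = n
      · subst h; rw [if_pos rfl, Nat.sub_self, if_pos rfl]
      · rw [if_neg h, if_neg (by omega)]
  rw [e, V_w_rev_of_order_eq K hkk' (Nat.zero_le _) (by omega) (P := 0) (fun j hj => if_neg (by omega)) (by rw [if_pos rfl]; exact hc), Nat.sub_zero]

end Summit.Ventures.HSemireg.Wedge.KernelDuality
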